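import Literature.Topology.FourManifolds.TrisectionCentralSurfaceMarking
import Literature.Topology.FourManifolds.FlowerHandlebody
import HarnessLib

/-!
# Transport of a marking of the flower surface to the central surface of a trisection

Topic `Literature/Topology/FourManifolds`; fact seat
`provefact-Literature.Topology.FourManifolds.exists-cbed50d78a` (named fact (g′)
`Literature.Topology.FourManifolds.exists_marking_centralSurface_of_gkTrisection`).  The reduction
`exists_marking_centralSurface_of_gkTrisection_of_model` (`TrisectionCentralSurfaceMarking.lean`)
derives (g′) in genus `g` from the `1`-handle lemma L1 (`oneHandle_nonempty_diffeomorph`) and ONE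
genus-`g` handlebody whose boundary is marked by `S_g` at every base point.  For `g ≥ 2` the
explicit model is the flower handlebody `V_g = {q_g + z² ≤ c_g}` (`FlowerHandlebody.lean`,
`isHandlebody_flowerHandlebody`, `boundaryHomeomorph : ∂V_g ≃ₜ {q_g + z² = c_g}`); this file
performs the bookkeeping: a marking of the flower surface `{q_g + z² = c_g}` at every base point
marks `∂V_g` (`flowerHandlebody_marking`) and `∂(ULift V_g)` (`flowerHandlebodyULift_marking`,
through `ManifoldULift.diffeomorph` and `Diffeomorph.boundaryHomeomorph`), whence
**`exists_marking_centralSurface_of_flower_marking`: (g′) in genus `g ≥ 2` from L1 and a marking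
of the flower surface.**  The marking of the flower surface itself (Hatcher, §1.2 p. 51:
`π₁(Σ_g) = S_g`, for this explicit surface) is the subject of the sequels (`FlowerSector*.lean`,
`FlowerFanCollar.lean`, …).  Everything here is proved; no named facts.

## References

* D. Gay, R. Kirby, *Trisecting 4-manifolds*, Geom. Topol. 20 (2016), Def. 1, Remark 2 (p. 3098).
  [GayKirby2016]
* A. Hatcher, *Algebraic Topology*, CUP (2002), §1.2 p. 51. [HatcherAT2002]
-/

open scoped Manifold ContDiff Topology
open Set Function Literature Literature.Topology.FourManifolds.FlowerModel
  Literature.AlgebraicTopology.FundamentalGroup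

noncomputable section

namespace Literature.Topology.FourManifolds

universe u

/-- Local notation: `𝔼 n` is the model Euclidean space `EuclideanSpace ℝ (Fin n)`. -/
local notation "𝔼 " n:arg => EuclideanSpace ℝ (Fin n)

section Transport

variable {g : ℕ}

/-- **A marking of the flower surface marks the boundary of the flower handlebody**, at every base
point: `∂V_g ≃ₜ {q_g + z² = c_g}` (`FlowerModel.boundaryHomeomorph`). [folklore] -/
theorem flowerHandlebody_marking (hg : 2 ≤ g)
    (hM : ∀ x : {p : 𝔼 3 | PlanarThickening.thicken (flower g) p = level g},
      Nonempty (SurfaceGroup g ≃* FundamentalGroup {p : 𝔼 3 | PlanarThickening.thicken (flower g) p = level g} x))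
    (z : (𝓡∂ 3).boundary (FlowerHandlebody hg)) :
    Nonempty (SurfaceGroup g ≃* FundamentalGroup ((𝓡∂ 3).boundary (FlowerHandlebody hg)) z) := by
  obtain ⟨e⟩ := hM (boundaryHomeomorph hg z)
  exact ⟨e.trans (fundamentalGroupEquivOfHomeomorph (boundaryHomeomorph hg) rfl).symm⟩

/-- **The same for the universe lift of the flower handlebody** (`ULift V_g ≃ₘ V_g` preserves the
boundary). [folklore] -/
theorem flowerHandlebodyULift_marking (hg : 2 ≤ g)
    (hM : ∀ x : {p : 𝔼 3 | PlanarThickening.thicken (flower g) p = level g},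
      Nonempty (SurfaceGroup g ≃* FundamentalGroup {p : 𝔼 3 | PlanarThickening.thicken (flower g) p = level g} x))
    (z : (𝓡∂ 3).boundary (ULift.{u} (FlowerHandlebody hg))) :
    Nonempty (SurfaceGroup g ≃* FundamentalGroup ((𝓡∂ 3).boundary (ULift.{u} (FlowerHandlebody hg))) z) := by
  set φ := (ManifoldULift.diffeomorph (𝓡∂ 3) (FlowerHandlebody hg) ∞).boundaryHomeomorph (by simp) with hφ
  obtain ⟨e⟩ := flowerHandlebody_marking hg hM (φ z)
  exact ⟨e.trans (fundamentalGroupEquivOfHomeomorph φ rfl).symm⟩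

/-- **(g′) for `g ≥ 2` from L1 and a marking of the flower surface.**  Granted the uniqueness of
attaching a `1`-handle (`oneHandle_nonempty_diffeomorph`, L1) and a marking
`S_g ≃* π₁({q_g + z² = c_g}, x)` of the flower surface at every base point (the boundary of the
explicit genus-`g` handlebody `V_g`, `FlowerHandlebody.lean`), the central surface of every balanced
`(g, k)`-trisection of a closed connected oriented smooth `4`-manifold is marked by `S_g`: by
`exists_marking_centralSurface_of_gkTrisection_of_model` for the model `ULift V_g`.
[cite: GayKirby2016, Def. 1 and Remark 2 (p. 3098)] [cite: HatcherAT2002, §1.2 p. 51] -/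
theorem exists_marking_centralSurface_of_flower_marking (hg : 2 ≤ g)
    (h₁ : oneHandle_nonempty_diffeomorph.{u})
    (hM : ∀ x : {p : 𝔼 3 | PlanarThickening.thicken (flower g) p = level g},
      Nonempty (SurfaceGroup g ≃* FundamentalGroup {p : 𝔼 3 | PlanarThickening.thicken (flower g) p = level g} x))
    (X : Type u) [TopologicalSpace X] [T2Space X] [SecondCountableTopology X]
    [ChartedSpace (𝔼 4) X] [IsManifold (𝓡 4) ∞ X] [CompactSpace X]
    [ConnectedSpace X] (o : SmoothOrientation (𝓡 4) X) (k : ℕ) (S : Fin 3 → Set X)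
    (h : IsBalancedGKTrisection X g k S) :
    ∃ x₀ : centralSurface S, Nonempty (SurfaceGroup g ≃* FundamentalGroup (centralSurface S) x₀) :=
  exists_marking_centralSurface_of_gkTrisection_of_model h₁
    (ManifoldULift.isHandlebody (isHandlebody_flowerHandlebody hg))
    (flowerHandlebodyULift_marking hg hM) X o k S h

end Transport

end Literature.Topology.FourManifolds
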